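import Summits.HodgeConjecture.HodgeConjecture.Theses.PadicSemiregularLift
import Literature.AlgebraicGeometry.Crystalline.HodgeDeRhamDegeneration
import HarnessLib

/-!
# Route `PadicSemiregularLift`, support item `HodgeDeRhamDegeneration` (stmt-HodgeConjecture-15974)

The route declaration `Theses.PadicSemiregularLift.HodgeDeRhamDegeneration` is, verbatim, the body
of the Literature named fact `Literature.AlgebraicGeometry.Crystalline.HodgeDeRhamDegeneratesModTorsion`
(Deligne 1968, Thm. 5.5 (ii): degeneration of the Hodge–de Rham spectral sequence modulo torsion for
a smooth proper `𝒳/W(k)`, phrased as "every connecting homomorphism of the stupid filtration of the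
algebraic de Rham complex has torsion values in hypercohomology"). This file records

* `hodgeDeRhamDegeneration_iff_degeneratesModTorsion` — the two propositions are definitionally the
  same (`Iff.rfl`), so any proof `X_holds` of the named fact closes the item by `:= X_holds`;
* `hodgeDeRhamDegeneration_of_degeneratesModTorsion` — the CONDITIONAL discharge of the route item
  from the named fact (a `conditional-result` on Deligne 1968; the fact itself — Hodge theory, or
  Deligne–Illusie with spreading out and flat base change `W → W[1/p]` — has no carrier in the tree).

No statement is weakened or restated; nothing here is unconditional progress on Deligne's theorem.
-/

-- `Summit.HodgeConjecture.HodgeConjecture.Theorems` is the mandated namespace (single-conjunct summit: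
-- Sub = Summit), which `linter.dupNamespace` flags on every declaration; the lakefile turns the
-- linter off tree-wide (weak option), restated here so stand-alone elaboration is warning-free too.
set_option linter.dupNamespace false

namespace Summit.HodgeConjecture.HodgeConjecture.Theorems

/-- The route item `HodgeDeRhamDegeneration` of `PadicSemiregularLift` is definitionally the
Literature named fact `Crystalline.HodgeDeRhamDegeneratesModTorsion` (Deligne 1968, Thm. 5.5 (ii),
degeneration of Hodge–de Rham modulo torsion for smooth proper `𝒳/W(k)`): both sides are the same
term. [cite: Deligne1968, Thm. 5.5 (ii)] -/
theorem hodgeDeRhamDegeneration_iff_degeneratesModTorsion :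
    Theses.PadicSemiregularLift.HodgeDeRhamDegeneration ↔
      Literature.AlgebraicGeometry.Crystalline.HodgeDeRhamDegeneratesModTorsion :=
  Iff.rfl

/-- **Conditional discharge** of the route item `HodgeDeRhamDegeneration` from the Literature named
fact `Crystalline.HodgeDeRhamDegeneratesModTorsion` (Deligne 1968, Thm. 5.5 (ii)); conditional on
that (unproved, published) fact and nothing else. [cite: Deligne1968, Thm. 5.5 (ii)] -/
theorem hodgeDeRhamDegeneration_of_degeneratesModTorsion
    (hdeg : Literature.AlgebraicGeometry.Crystalline.HodgeDeRhamDegeneratesModTorsion) :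
    Theses.PadicSemiregularLift.HodgeDeRhamDegeneration :=
  hodgeDeRhamDegeneration_iff_degeneratesModTorsion.mpr hdeg

end Summit.HodgeConjecture.HodgeConjecture.Theorems
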